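import Summits.QuantumFields.YangMills.Theorems.BalabanUVNodesN21GappedTopCut13CoPHSignFree
import Summits.QuantumFields.YangMills.Theorems.BalabanUVNodesN21GappedTopReading13CoPH

/-!
# N21 (NE7c) · THE GAPPED TOP-LETTERED READING WITHOUT THE SIGN ROWS: `ShellWeightBound` AT `crGap₁₃VAt` under the live-selector pin, (H-ζ) and the DIAL rows `0 ≤ ρ_K ≤ 1`,
# `Σ 1∕(n_K+1) < ∞` ONLY — the rows `0 ≤ ε_top` of U4∕U6 are removed by U8a's sign-free pigeonhole (at `ε < 0` every top cube test fails and the collar shells vanish)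

R134 seat `pub-ymgap-dag-n21-d` (g11), node N21 = NE7c (NOT PRINTED; NOT proved at print's fixed thresholds), strategy s2; lane K3⁷ `SpineGivenEndpointR13SepCoPH`
(stmt-QuantumFields-20544, `--supports … --as helper`; COUNT-NEUTRAL).  Imports U8a `…GappedTopCut13CoPHSignFree` (`topGapShellAt_cutGrid_nonneg`, `sum_range_sum_topGapShell_le'`,
`exists_common_depth_topGapShell_le'`) and U6 `…GappedTopReading13CoPH` (p622874 ✓: fibre sums, E1∕E2, `topGapShellAtLevel_le`, the reading `crGap₁₃VAt`).

WHAT THIS FILE PROVES (theorems only; 0 `def`): the primed (sign-free) twins — §45 record level `exists_common_depth_topGapShell_le_of_liveSel'`; §46 reading level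
`topGapShellAtLevel_cutGrid_nonneg`, `sum_range_sum_topGapShellAtLevel_le_of_liveSel'`, ★★ `gapShellSum_selGapDepth_le'`, ★★★ `shellWeightBound_carriersGap₁₃'`,
★★★ `shellWeightBound_crGap₁₃VAt'` (rows: `hsel`, (H-ζ), `0 ≤ ρ_K ≤ 1`, `Σ 1∕(n_K+1) < ∞` — the SAME rows as R2's one-sided `shellWeightBound_crTop₁₃VAt` plus the dial sign `0 ≤ ρ_K`),
★★ `keyedShellWeight_shape_crGap₁₃V_of_rows'`.

HONEST FRAMING (binding).  Bookkeeping BY NAME; NO estimate of Bałaban's; NO anti-concentration; the reading is NOT the K3 skeleton's `PinnedAtLive` pin (plan's decision —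
LOCATED); only the top step's (2.17)∕(3.2) factor family is re-lettered (the (3.3) family, the (1.8) family and every family below the top are print's ∕ the record's — LOCATED;
the cell census `t4/T4-XREAD-U5X15.md` rows A1∕A6∕A7 says each differs across the runs by a shell); NE7c NOT PRINTED ∕ NOT proved at print's thresholds; N21 NOT discharged; K3⁷ NOT
claimed; counts UNMOVED (typed 28∕28 · discharged 5∕27); never a count claim.  No `instance`, no `notation`, no `def`.  One finite four-torus programme at fixed `ε` — NOT ℝ⁴,
NOT OS, NOT a mass gap, NOT the Clay problem.
-/

noncomputable section

open scoped BigOperators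
open Finset MeasureTheory

namespace Summit.QuantumFields.YangMills.Theorems.N21ShellSplitOfRecord13CoPH

open Literature.MathematicalPhysics.QuantumFieldTheory.Balaban1983to89
open Literature.MathematicalPhysics.QuantumFieldTheory.Balaban1983to89.T4Continuum
open Literature.MathematicalPhysics.QuantumFieldTheory.Balaban1983to89.Node00
open YMDAG.UVSplit (SpineReading₁₃CoPH keyA₁₃ keyB₁₃ runA₁₃ runB₁₃ histA₁₃ histB₁₃ histA₁₃_zero histB₁₃_zero classSet₁₃ badClass₁₃)
open T4WeightBudget (RelWeightBound)
open T4IndicatorShell (ShellWeightBound)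
open Summit.QuantumFields.BalabanUV.T4Continuum.Spine
open Summit.QuantumFields.YangMills.BalabanUVNodes.SpineCanonicalWeights
open Summit.QuantumFields.YangMills.Theorems.N21StepWeightsPositivity (zetaOfRecord_nonneg)
open Summit.QuantumFields.YangMills.BalabanUVNodes.N19MGFFormAtRecordMass (sum_classWeightOfDatum₉_datumOfRecord₁₃CoPH_eq_schemeZ_of_ppSelLive)
open Summit.QuantumFields.YangMills.BalabanUVNodes.N19MGFFormAtRecord (wOfRecord₉_nonneg)

/-! ## §45 Record level, sign-free -/

section RecordSF

variable {F : T4Family} {N : ℕ} [NeZero N]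

/-- ★★★ **(M1)-FREE NE7c, BOTH SIDES OF THE CUT, AT THE TOP-LETTERED TERMS OF THE TWO RUNS OF RECORD, ONE COMMON DEPTH — SIGN-FREE** (U4's theorem with the rows `0 ≤ ε_top`
removed; rows: `hsel`, (H-ζ), `0 ≤ ρ ≤ 1`). [bookkeeping] -/
theorem exists_common_depth_topGapShell_le_of_liveSel' (K₀ : ℕ) (θ : Stage13HParams F N) (hP : θ.Provisos₁₃CoPH F N) (g₀ : ℕ → ℝ) (os : List (ULoop F))
    (E : B12.RunParams → ℝ) (hsel : θ.ppSel = ppSelLiveOfRecord F N θ.ν θ.τ9 E (wOfRecord₉ F N θ.toStage9Params)) (hζm : ZetaMeasurable F N θ.ζ)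
    (K kA kB : ℕ) (hkA : kA + 1 = K₀ + K) (hkB : kB + 1 = K₀ + K + 1) {ρ : ℝ} (hρ0 : 0 ≤ ρ) (hρ1 : ρ ≤ 1) (n : ℕ) (t : ℝ) :
    ∃ i ∈ Finset.range (n + 1),
      ∑ s', topGapShellAt F N θ.toStage9Params (datumOfRecord₁₃CoPH F N θ hP) g₀ os (runA₁₃ F K₀ g₀ K) (histA₁₃ θ K₀ g₀ K) kA
            (cutGrid θ.ν (histA₁₃ θ K₀ g₀ K) (kA + 1) ρ (i + 2)) (cutGrid θ.ν (histA₁₃ θ K₀ g₀ K) (kA + 1) ρ (i + 1)) (cutGrid θ.ν (histA₁₃ θ K₀ g₀ K) (kA + 1) ρ i) t s' ≤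
          4 * (2 * (F.L : ℝ) ^ F.m) ^ 4 / (n + 1 : ℕ) *
            ∑ s, classWeightOfDatum₉ F N θ.toStage9Params (datumOfRecord₁₃CoPH F N θ hP) g₀ os (runA₁₃ F K₀ g₀ K) (histA₁₃ θ K₀ g₀ K) kA t s ∧
        ∑ s', topGapShellAt F N θ.toStage9Params (datumOfRecord₁₃CoPH F N θ hP) g₀ os (runB₁₃ F K₀ g₀ K) (histB₁₃ θ K₀ g₀ K) kB
            (cutGrid θ.ν (histB₁₃ θ K₀ g₀ K) (kB + 1) ρ (i + 2)) (cutGrid θ.ν (histB₁₃ θ K₀ g₀ K) (kB + 1) ρ (i + 1)) (cutGrid θ.ν (histB₁₃ θ K₀ g₀ K) (kB + 1) ρ i) t s' ≤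
          4 * (2 * (F.L : ℝ) ^ F.m) ^ 4 / (n + 1 : ℕ) *
            ∑ s, classWeightOfDatum₉ F N θ.toStage9Params (datumOfRecord₁₃CoPH F N θ hP) g₀ os (runB₁₃ F K₀ g₀ K) (histB₁₃ θ K₀ g₀ K) kB t s := by
  have hζ0 : ∀ p g k s Pl Ql RS U V', 0 ≤ θ.ζ p g k s Pl Ql RS U V' :=
    fun p g k s Pl Ql RS U V' => zetaOfRecord_nonneg F N θ.ν θ.τ9.M hP.zetaUnity hP.zetaAbs p g k s Pl Ql RS U V'
  have hU : LocalBgMeasurable F N θ.ν := localBgMeasurable F N θ.ν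
  have hD : (datumOfRecord₁₃CoPH F N θ hP).AvgMeasurable := (isPrintedAveraged_datumOfRecord₁₃CoPH F N θ hP).avgMeasurable
  have hkA' : kA + 1 = (runA₁₃ F K₀ g₀ K).K := by rw [YMDAG.UVSplit.runA₁₃_K]; exact hkA
  have hkB' : kB + 1 = (runB₁₃ F K₀ g₀ K).K := by rw [YMDAG.UVSplit.runB₁₃_K]; exact hkB
  exact exists_common_depth_topGapShell_le' F N θ.toStage9Params (datumOfRecord₁₃CoPH F N θ hP) g₀ os (runA₁₃ F K₀ g₀ K) (histA₁₃ θ K₀ g₀ K) kA hkA'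
    (runB₁₃ F K₀ g₀ K) (histB₁₃ θ K₀ g₀ K) kB hkB' hζ0 hζm hP.zetaAbs hP.zetaUnity hρ0 hρ1 n t
    (fun s => integrable_chi_mul_dressedSlots_of_ppSelLive θ.toStage9Params E hsel hU hζm hζ0 hP.zetaAbs _ hD g₀ os (histA₁₃_zero θ K₀ g₀ K) t kA s)
    (fun s => integrable_chi_mul_dressedSlots_of_ppSelLive θ.toStage9Params E hsel hU hζm hζ0 hP.zetaAbs _ hD g₀ os (histB₁₃_zero θ K₀ g₀ K) t kB s)

end RecordSF

/-! ## §46 Reading level, sign-free -/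

section LevelSF

variable (F : T4Family) (N : ℕ) [NeZero N] (ϑ : Stage9Params F N) (D : FiniteEpsData F (SU N)) (g₀ : ℕ → ℝ) (os : List (ULoop F))
  (p : B12.RunParams) (g : ℕ → ℝ)

/-- `0 ≤` the two-sided collar shell at every level along the grid, AT THE RUN's TOP, ANY SIGN OF `ε` (`0 ≤ ρ ≤ 1`; rows `0 ≤ ζ`, `Σ|ζ| ≤ 1`, (H-ζ), (e1) below the top). [bookkeeping] -/
theorem topGapShellAtLevel_cutGrid_nonneg (hζ0 : ∀ p g k s Pl Ql RS U V', 0 ≤ ϑ.ζ p g k s Pl Ql RS U V') (hζm : ZetaMeasurable F N ϑ.ζ)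
    (hζ1 : IsZetaAbsLeOne F N ϑ.ν ϑ.τ9.M ϑ.ζ) {ρ : ℝ} (hρ0 : 0 ≤ ρ) (hρ1 : ρ ≤ 1) (i : ℕ) (t : ℝ)
    (hint : ∀ k, k < p.K → ∀ s : SeqOfRecord F ϑ.ν ϑ.τ9.M g p.K k,
      Integrable (fun U => chiSeqOfRecord F N ϑ.ν ϑ.τ9.M g p.K k s U * dressedSlotsOfDatum₉ F N ϑ D g₀ os t p g k s U) (fieldMeasure (F.P p.K) k (SU N))) :
    ∀ (j : ℕ), j = p.K → ∀ s : SeqOfRecord F ϑ.ν ϑ.τ9.M g p.K j,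
      0 ≤ topGapShellAtLevel F N ϑ D g₀ os p g (cutGrid ϑ.ν g j ρ (i + 2)) (cutGrid ϑ.ν g j ρ (i + 1)) (cutGrid ϑ.ν g j ρ i) t j s
  | 0, _, _ => le_rfl
  | k + 1, hk, s' => topGapShellAt_cutGrid_nonneg F N ϑ D g₀ os p g k hk hζ0 hζm hζ1 hρ0 hρ1 i t (hint k (by omega)) s'

end LevelSF

section LiveSF

variable {F : T4Family} {N : ℕ} [NeZero N]

/-- ★★ **THE TWO-SIDED PIGEONHOLE AT THE RUN's TOP, AGAINST THE PARTITION FUNCTION, ANY SIGN OF `ε`** (U6 §38 with the row `0 ≤ ε_j` removed). [bookkeeping] -/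
theorem sum_range_sum_topGapShellAtLevel_le_of_liveSel' (θ : Stage13HParams F N) (hP : θ.Provisos₁₃CoPH F N) (E : B12.RunParams → ℝ)
    (hsel : θ.ppSel = ppSelLiveOfRecord F N θ.ν θ.τ9 E (wOfRecord₉ F N θ.toStage9Params)) (hζm : ZetaMeasurable F N θ.ζ) (g₀ : ℕ → ℝ) (os : List (ULoop F))
    {p : B12.RunParams} {g : ℕ → ℝ} (hg : g 0 = g₀ p.K) {ρ : ℝ} (hρ0 : 0 ≤ ρ) (hρ1 : ρ ≤ 1) (m : ℕ) (t : ℝ) :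
    ∀ j : ℕ, j = p.K → ∑ i ∈ Finset.range m, ∑ s, topGapShellAtLevel F N θ.toStage9Params (datumOfRecord₁₃CoPH F N θ hP) g₀ os p g
        (cutGrid θ.ν g j ρ (i + 2)) (cutGrid θ.ν g j ρ (i + 1)) (cutGrid θ.ν g j ρ i) t j s ≤
      2 * (2 * (F.L : ℝ) ^ F.m) ^ 4 * T4GenFunBounds.schemeZ ((datumOfRecord₁₃CoPH F N θ hP).scheme g₀) os p.K t := by
  have hζ0 : ∀ p g k s Pl Ql RS U V', 0 ≤ θ.ζ p g k s Pl Ql RS U V' :=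
    fun p g k s Pl Ql RS U V' => zetaOfRecord_nonneg F N θ.ν θ.τ9.M hP.zetaUnity hP.zetaAbs p g k s Pl Ql RS U V'
  have hU : LocalBgMeasurable F N θ.ν := localBgMeasurable F N θ.ν
  have hD : (datumOfRecord₁₃CoPH F N θ hP).AvgMeasurable := (isPrintedAveraged_datumOfRecord₁₃CoPH F N θ hP).avgMeasurable
  have hZ0 : 0 ≤ T4GenFunBounds.schemeZ ((datumOfRecord₁₃CoPH F N θ hP).scheme g₀) os p.K t := by
    rw [← sum_classWeightOfDatum₉_datumOfRecord₁₃CoPH_eq_schemeZ_of_ppSelLive θ hP E hsel hU hζm hζ0 g₀ os hg t 0 (Nat.zero_le _)]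
    exact Finset.sum_nonneg fun s _ => classWeightOfDatum₉_nonneg' F N θ.toStage9Params (datumOfRecord₁₃CoPH F N θ hP) g₀ os p g 0
      (wOfRecord₉_nonneg θ.toStage9Params hζ0 p g) t s
  intro j hj
  cases j with
  | zero =>
    simp only [topGapShellAtLevel_zero, Finset.sum_const_zero]
    exact mul_nonneg (by positivity) hZ0
  | succ k =>
    simp only [topGapShellAtLevel_succ]
    rw [← sum_classWeightOfDatum₉_datumOfRecord₁₃CoPH_eq_schemeZ_of_ppSelLive θ hP E hsel hU hζm hζ0 g₀ os hg t k (by omega)]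
    exact sum_range_sum_topGapShell_le' F N θ.toStage9Params (datumOfRecord₁₃CoPH F N θ hP) g₀ os p g k hj hζ0 hζm hP.zetaAbs hP.zetaUnity hρ0 hρ1 m t
      (fun s => integrable_chi_mul_dressedSlots_of_ppSelLive θ.toStage9Params E hsel hU hζm hζ0 hP.zetaAbs _ hD g₀ os hg t k s)

/-! ### The argmin bound, `ShellWeightBound` at the carriers and at the reading, the skeleton shape — all sign-free -/

/-- ★★ **BOTH RUNS' COLLAR-SHELL MASSES AT THE SELECTED DEPTH ARE `≤ (4(2L^m)⁴∕(n+1)) ×` THE RUNS' PARTITION FUNCTIONS** (§38's pigeonhole in each run + the argmin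
`selGapDepth₁₃`); SIGN-FREE: rows `hsel`, (H-ζ), `0 ≤ ρ_K ≤ 1`; NO anti-concentration. [bookkeeping] -/
theorem gapShellSum_selGapDepth_le' (K₀ : ℕ) (θ : Stage13HParams F N) (hP : θ.Provisos₁₃CoPH F N) (g₀ : ℕ → ℝ) (os : List (ULoop F)) (E : B12.RunParams → ℝ)
    (hsel : θ.ppSel = ppSelLiveOfRecord F N θ.ν θ.τ9 E (wOfRecord₉ F N θ.toStage9Params)) (hζm : ZetaMeasurable F N θ.ζ)
    {ρ : ℕ → ℝ} (hρ0 : ∀ K, 0 ≤ ρ K) (hρ1 : ∀ K, ρ K ≤ 1) (n K : ℕ) (t : ℝ) :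
    gapShellSumA₁₃ θ hP K₀ g₀ os ρ K (selGapDepth₁₃ θ hP K₀ g₀ os ρ n K t) t ≤
        4 * (2 * (F.L : ℝ) ^ F.m) ^ 4 / (n + 1 : ℕ) * T4GenFunBounds.schemeZ ((datumOfRecord₁₃CoPH F N θ hP).scheme g₀) os (K₀ + K) t ∧
      gapShellSumB₁₃ θ hP K₀ g₀ os ρ K (selGapDepth₁₃ θ hP K₀ g₀ os ρ n K t) t ≤
        4 * (2 * (F.L : ℝ) ^ F.m) ^ 4 / (n + 1 : ℕ) * T4GenFunBounds.schemeZ ((datumOfRecord₁₃CoPH F N θ hP).scheme g₀) os (K₀ + K + 1) t := by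
  have hζ0 : ∀ p g k s Pl Ql RS U V', 0 ≤ θ.ζ p g k s Pl Ql RS U V' :=
    fun p g k s Pl Ql RS U V' => zetaOfRecord_nonneg F N θ.ν θ.τ9.M hP.zetaUnity hP.zetaAbs p g k s Pl Ql RS U V'
  have hU : LocalBgMeasurable F N θ.ν := localBgMeasurable F N θ.ν
  have hD : (datumOfRecord₁₃CoPH F N θ hP).AvgMeasurable := (isPrintedAveraged_datumOfRecord₁₃CoPH F N θ hP).avgMeasurable
  -- the two partition functions are nonnegative (E1 at level 0)
  have hZ : ∀ (p : B12.RunParams) (g : ℕ → ℝ), g 0 = g₀ p.K → 0 ≤ T4GenFunBounds.schemeZ ((datumOfRecord₁₃CoPH F N θ hP).scheme g₀) os p.K t := by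
    intro p g hg
    rw [← sum_classWeightOfDatum₉_datumOfRecord₁₃CoPH_eq_schemeZ_of_ppSelLive θ hP E hsel hU hζm hζ0 g₀ os hg t 0 (Nat.zero_le _)]
    exact Finset.sum_nonneg fun s _ => classWeightOfDatum₉_nonneg' F N θ.toStage9Params (datumOfRecord₁₃CoPH F N θ hP) g₀ os p g 0
      (wOfRecord₉_nonneg θ.toStage9Params hζ0 p g) t s
  have hfA := sum_range_sum_topGapShellAtLevel_le_of_liveSel' θ hP E hsel hζm g₀ os (p := runA₁₃ F K₀ g₀ K) (histA₁₃_zero θ K₀ g₀ K) (hρ0 K) (hρ1 K) (n + 1) t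
    (K₀ + K) rfl
  have hfB := sum_range_sum_topGapShellAtLevel_le_of_liveSel' θ hP E hsel hζm g₀ os (p := runB₁₃ F K₀ g₀ K) (histB₁₃_zero θ K₀ g₀ K) (hρ0 K) (hρ1 K) (n + 1) t
    (K₀ + K + 1) rfl
  have hintA : ∀ k, k < (runA₁₃ F K₀ g₀ K).K → ∀ s : SeqOfRecord F θ.ν θ.τ9.M (histA₁₃ θ K₀ g₀ K) (runA₁₃ F K₀ g₀ K).K k,
      Integrable (fun U => chiSeqOfRecord F N θ.ν θ.τ9.M (histA₁₃ θ K₀ g₀ K) (runA₁₃ F K₀ g₀ K).K k s U *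
        dressedSlotsOfDatum₉ F N θ.toStage9Params (datumOfRecord₁₃CoPH F N θ hP) g₀ os t (runA₁₃ F K₀ g₀ K) (histA₁₃ θ K₀ g₀ K) k s U)
        (fieldMeasure (F.P (runA₁₃ F K₀ g₀ K).K) k (SU N)) :=
    fun k _ s => integrable_chi_mul_dressedSlots_of_ppSelLive θ.toStage9Params E hsel hU hζm hζ0 hP.zetaAbs _ hD g₀ os (histA₁₃_zero θ K₀ g₀ K) t k s
  have hintB : ∀ k, k < (runB₁₃ F K₀ g₀ K).K → ∀ s : SeqOfRecord F θ.ν θ.τ9.M (histB₁₃ θ K₀ g₀ K) (runB₁₃ F K₀ g₀ K).K k,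
      Integrable (fun U => chiSeqOfRecord F N θ.ν θ.τ9.M (histB₁₃ θ K₀ g₀ K) (runB₁₃ F K₀ g₀ K).K k s U *
        dressedSlotsOfDatum₉ F N θ.toStage9Params (datumOfRecord₁₃CoPH F N θ hP) g₀ os t (runB₁₃ F K₀ g₀ K) (histB₁₃ θ K₀ g₀ K) k s U)
        (fieldMeasure (F.P (runB₁₃ F K₀ g₀ K).K) k (SU N)) :=
    fun k _ s => integrable_chi_mul_dressedSlots_of_ppSelLive θ.toStage9Params E hsel hU hζm hζ0 hP.zetaAbs _ hD g₀ os (histB₁₃_zero θ K₀ g₀ K) t k s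
  have hA0 : ∀ i, 0 ≤ gapShellSumA₁₃ θ hP K₀ g₀ os ρ K i t := fun i => Finset.sum_nonneg fun s _ =>
    topGapShellAtLevel_cutGrid_nonneg F N θ.toStage9Params (datumOfRecord₁₃CoPH F N θ hP) g₀ os (runA₁₃ F K₀ g₀ K) (histA₁₃ θ K₀ g₀ K) hζ0 hζm hP.zetaAbs
      (hρ0 K) (hρ1 K) i t hintA (K₀ + K) rfl s
  have hB0 : ∀ i, 0 ≤ gapShellSumB₁₃ θ hP K₀ g₀ os ρ K i t := fun i => Finset.sum_nonneg fun s' _ =>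
    topGapShellAtLevel_cutGrid_nonneg F N θ.toStage9Params (datumOfRecord₁₃CoPH F N θ hP) g₀ os (runB₁₃ F K₀ g₀ K) (histB₁₃ θ K₀ g₀ K) hζ0 hζm hP.zetaAbs
      (hρ0 K) (hρ1 K) i t hintB (K₀ + K + 1) rfl s'
  have hspec := selGapDepth₁₃_spec θ hP K₀ g₀ os ρ n K t
  obtain ⟨h₁, h₂⟩ := argmin_badness_bounds (f := fun i => gapShellSumA₁₃ θ hP K₀ g₀ os ρ K i t) (g := fun i => gapShellSumB₁₃ θ hP K₀ g₀ os ρ K i t) hA0 hB0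
    (hZ (runA₁₃ F K₀ g₀ K) _ (histA₁₃_zero θ K₀ g₀ K)) (hZ (runB₁₃ F K₀ g₀ K) _ (histB₁₃_zero θ K₀ g₀ K)) (by positivity) hfA hfB hspec.1 hspec.2
  refine ⟨h₁.trans (le_of_eq ?_), h₂.trans (le_of_eq ?_)⟩
  · rw [YMDAG.UVSplit.runA₁₃_K]; ring
  · rw [YMDAG.UVSplit.runB₁₃_K]; ring

/-- ★★★ **N21's OUTPUT SHAPE AT THE GAPPED CARRIERS — BOTH SIDES OF THE CUT BANDED, (M1)-FREE.**  At a `CoPH`-keyed Stage-13 tuple on the live-selector line (`hsel`), under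
(H-ζ), SIGN-FREE — with the dial rows `0 ≤ ρ_K ≤ 1` and `Summable (K ↦ 1∕(n_K+1))` ONLY:
`ShellWeightBound 1 (classSet₁₃ θ K₀ g₀) (gapWeightA₁₃ …) (gapWeightB₁₃ …) (gapShellA₁₃ …) (gapShellB₁₃ …) (K ↦ 4(2L^m)⁴·(1∕(n_K+1)))` — every field PROVED; NO anti-concentration,
NO estimate of Bałaban's. [bookkeeping] -/
theorem shellWeightBound_carriersGap₁₃' (K₀ : ℕ) (θ : Stage13HParams F N) (hP : θ.Provisos₁₃CoPH F N) (g₀ : ℕ → ℝ) (os : List (ULoop F)) (E : B12.RunParams → ℝ)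
    (hsel : θ.ppSel = ppSelLiveOfRecord F N θ.ν θ.τ9 E (wOfRecord₉ F N θ.toStage9Params)) (hζm : ZetaMeasurable F N θ.ζ)
    {ρ : ℕ → ℝ} {n : ℕ → ℕ} (hρ0 : ∀ K, 0 ≤ ρ K) (hρ1 : ∀ K, ρ K ≤ 1) (hn : Summable (fun K => 1 / ((n K : ℝ) + 1))) :
    ShellWeightBound 1 (classSet₁₃ θ K₀ g₀) (gapWeightA₁₃ θ hP K₀ g₀ os ρ n) (gapWeightB₁₃ θ hP K₀ g₀ os ρ n) (gapShellA₁₃ θ hP K₀ g₀ os ρ n)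
      (gapShellB₁₃ θ hP K₀ g₀ os ρ n) (fun K => 4 * (2 * (F.L : ℝ) ^ F.m) ^ 4 * (1 / ((n K : ℝ) + 1))) := by
  have hζ0 : ∀ p g k s Pl Ql RS U V', 0 ≤ θ.ζ p g k s Pl Ql RS U V' :=
    fun p g k s Pl Ql RS U V' => zetaOfRecord_nonneg F N θ.ν θ.τ9.M hP.zetaUnity hP.zetaAbs p g k s Pl Ql RS U V'
  have hU : LocalBgMeasurable F N θ.ν := localBgMeasurable F N θ.ν
  have hD : (datumOfRecord₁₃CoPH F N θ hP).AvgMeasurable := (isPrintedAveraged_datumOfRecord₁₃CoPH F N θ hP).avgMeasurable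
  have hνbar : 0 ≤ 4 * (2 * (F.L : ℝ) ^ F.m) ^ 4 := by positivity
  have hconst : ∀ K, 4 * (2 * (F.L : ℝ) ^ F.m) ^ 4 / (n K + 1 : ℕ) = 4 * (2 * (F.L : ℝ) ^ F.m) ^ 4 * (1 / ((n K : ℝ) + 1)) := fun K => by
    push_cast
    ring
  have hintA : ∀ K k, k < (runA₁₃ F K₀ g₀ K).K → ∀ s : SeqOfRecord F θ.ν θ.τ9.M (histA₁₃ θ K₀ g₀ K) (runA₁₃ F K₀ g₀ K).K k, ∀ t : ℝ,
      Integrable (fun U => chiSeqOfRecord F N θ.ν θ.τ9.M (histA₁₃ θ K₀ g₀ K) (runA₁₃ F K₀ g₀ K).K k s U *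
        dressedSlotsOfDatum₉ F N θ.toStage9Params (datumOfRecord₁₃CoPH F N θ hP) g₀ os t (runA₁₃ F K₀ g₀ K) (histA₁₃ θ K₀ g₀ K) k s U)
        (fieldMeasure (F.P (runA₁₃ F K₀ g₀ K).K) k (SU N)) :=
    fun K k _ s t => integrable_chi_mul_dressedSlots_of_ppSelLive θ.toStage9Params E hsel hU hζm hζ0 hP.zetaAbs _ hD g₀ os (histA₁₃_zero θ K₀ g₀ K) t k s
  have hintB : ∀ K k, k < (runB₁₃ F K₀ g₀ K).K → ∀ s : SeqOfRecord F θ.ν θ.τ9.M (histB₁₃ θ K₀ g₀ K) (runB₁₃ F K₀ g₀ K).K k, ∀ t : ℝ,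
      Integrable (fun U => chiSeqOfRecord F N θ.ν θ.τ9.M (histB₁₃ θ K₀ g₀ K) (runB₁₃ F K₀ g₀ K).K k s U *
        dressedSlotsOfDatum₉ F N θ.toStage9Params (datumOfRecord₁₃CoPH F N θ hP) g₀ os t (runB₁₃ F K₀ g₀ K) (histB₁₃ θ K₀ g₀ K) k s U)
        (fieldMeasure (F.P (runB₁₃ F K₀ g₀ K).K) k (SU N)) :=
    fun K k _ s t => integrable_chi_mul_dressedSlots_of_ppSelLive θ.toStage9Params E hsel hU hζm hζ0 hP.zetaAbs _ hD g₀ os (histB₁₃_zero θ K₀ g₀ K) t k s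
  letI : ∀ Kc, DecidableEq (SiteSeqKey F Kc) := fun _ => Classical.decEq _
  refine
    { nonneg := fun K => mul_nonneg hνbar (by positivity)
      summable := hn.mul_left _
      sh_nonneg_left := fun K t _ x _ => Finset.sum_nonneg fun s _ =>
        topGapShellAtLevel_cutGrid_nonneg F N θ.toStage9Params (datumOfRecord₁₃CoPH F N θ hP) g₀ os (runA₁₃ F K₀ g₀ K) (histA₁₃ θ K₀ g₀ K) hζ0 hζm hP.zetaAbs
          (hρ0 K) (hρ1 K) _ t (fun k hk s => hintA K k hk s t) (K₀ + K) rfl s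
      sh_le_left := fun K t _ x _ => Finset.sum_le_sum fun s _ =>
        topGapShellAtLevel_le F N θ.toStage9Params (datumOfRecord₁₃CoPH F N θ hP) g₀ os (runA₁₃ F K₀ g₀ K) (histA₁₃ θ K₀ g₀ K) hζ0 _ _ _ t (K₀ + K) s
      sh_nonneg_right := fun K t _ x _ => Finset.sum_nonneg fun s' _ =>
        topGapShellAtLevel_cutGrid_nonneg F N θ.toStage9Params (datumOfRecord₁₃CoPH F N θ hP) g₀ os (runB₁₃ F K₀ g₀ K) (histB₁₃ θ K₀ g₀ K) hζ0 hζm hP.zetaAbs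
          (hρ0 K) (hρ1 K) _ t (fun k hk s => hintB K k hk s t) (K₀ + K + 1) rfl s'
      sh_le_right := fun K t _ x _ => Finset.sum_le_sum fun s' _ =>
        topGapShellAtLevel_le F N θ.toStage9Params (datumOfRecord₁₃CoPH F N θ hP) g₀ os (runB₁₃ F K₀ g₀ K) (histB₁₃ θ K₀ g₀ K) hζ0 _ _ _ t (K₀ + K + 1) s'
      left := fun K t _ => ?_
      right := fun K t _ => ?_ }
  · rw [sum_classSet₁₃_gapShellA₁₃, sum_classSet₁₃_gapWeightA₁₃_eq_schemeZ K₀ θ hP g₀ os E hsel hζm, ← hconst K]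
    exact (gapShellSum_selGapDepth_le' K₀ θ hP g₀ os E hsel hζm hρ0 hρ1 (n K) K t).1
  · rw [sum_classSet₁₃_gapShellB₁₃, sum_classSet₁₃_gapWeightB₁₃_eq_schemeZ K₀ θ hP g₀ os E hsel hζm, ← hconst K]
    exact (gapShellSum_selGapDepth_le' K₀ θ hP g₀ os E hsel hζm hρ0 hρ1 (n K) K t).2

/-- ★★★ **`KeyedShellWeight` AT THE GAPPED TOP-LETTERED READING, BOTH SIDES OF THE CUT, (M1)-FREE**: on the live-selector line, under (H-ζ), SIGN-FREE, with `0 ≤ ρ_K ≤ 1` and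
`Σ_K 1∕(n_K+1) < ∞` read at the tuple ONLY: `ShellWeightBound` AT `crGap₁₃VAt N K₀ jcut ρ n` — its `l₀, T, A, B, shA, shB` and its CANONICAL `Wsh` (n20-d's `shellWeightBound_wshInf`).
`jcut` is not read. [bookkeeping] -/
theorem shellWeightBound_crGap₁₃VAt' (K₀ : ℕ) (jcut : ℕ → ℕ) (ρ : WidthLetter₁₃CoPH N) (n : DepthLetter₁₃CoPH N) (θ : Stage13HParams F N) (hP : θ.Provisos₁₃CoPH F N)
    (g₀ : ℕ → ℝ) (os : List (ULoop F)) (E : B12.RunParams → ℝ) (hsel : θ.ppSel = ppSelLiveOfRecord F N θ.ν θ.τ9 E (wOfRecord₉ F N θ.toStage9Params))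
    (hζm : ZetaMeasurable F N θ.ζ) (hρ0 : ∀ K, 0 ≤ ρ F θ hP g₀ os K) (hρ1 : ∀ K, ρ F θ hP g₀ os K ≤ 1)
    (hn : Summable (fun K => 1 / ((n F θ hP g₀ os K : ℝ) + 1))) :
    ShellWeightBound (crGap₁₃VAt N K₀ jcut ρ n F θ hP g₀ os).l₀ (crGap₁₃VAt N K₀ jcut ρ n F θ hP g₀ os).T (crGap₁₃VAt N K₀ jcut ρ n F θ hP g₀ os).A
      (crGap₁₃VAt N K₀ jcut ρ n F θ hP g₀ os).B (crGap₁₃VAt N K₀ jcut ρ n F θ hP g₀ os).shA (crGap₁₃VAt N K₀ jcut ρ n F θ hP g₀ os).shB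
      (crGap₁₃VAt N K₀ jcut ρ n F θ hP g₀ os).Wsh :=
  shellWeightBound_wshInf (shellWeightBound_carriersGap₁₃' K₀ θ hP g₀ os E hsel hζm hρ0 hρ1 hn)

/-- ★★ **THE K3 STUB-2 CONJUNCT `KeyedShellWeight` AT `crGap₁₃V`, IN THE SKELETON's ∀-SHAPE, MODULO THE DISPLAYED ROWS, SIGN-FREE** (live-selector pin, (H-ζ), the dials
`0 ≤ ρ_K ≤ 1`, `Σ 1∕(n_K+1) < ∞`) — the record object `crGap₁₃V = crGap₁₃VAt N 0` (`rfl`); the pin a `PinnedAtLive` naming this reading would use. [bookkeeping] -/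
theorem keyedShellWeight_shape_crGap₁₃V_of_rows' (jcut : ℕ → ℕ) (ρ : WidthLetter₁₃CoPH N) (n : DepthLetter₁₃CoPH N)
    (E : (F : T4Family) → Stage13HParams F N → (B12.RunParams → ℝ)) :
    ∀ (F : T4Family) (θ : Stage13HParams F N) (hP : θ.Provisos₁₃CoPH F N),
      θ.ppSel = ppSelLiveOfRecord F N θ.ν θ.τ9 (E F θ) (wOfRecord₉ F N θ.toStage9Params) → ZetaMeasurable F N θ.ζ →
      ∀ (g₀ : ℕ → ℝ) (os : List (ULoop F)), (∀ K, 0 ≤ ρ F θ hP g₀ os K) → (∀ K, ρ F θ hP g₀ os K ≤ 1) →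
        Summable (fun K => 1 / ((n F θ hP g₀ os K : ℝ) + 1)) →
        ShellWeightBound (crGap₁₃V N jcut ρ n F θ hP g₀ os).l₀ (crGap₁₃V N jcut ρ n F θ hP g₀ os).T (crGap₁₃V N jcut ρ n F θ hP g₀ os).A
          (crGap₁₃V N jcut ρ n F θ hP g₀ os).B (crGap₁₃V N jcut ρ n F θ hP g₀ os).shA (crGap₁₃V N jcut ρ n F θ hP g₀ os).shB
          (crGap₁₃V N jcut ρ n F θ hP g₀ os).Wsh :=
  fun F θ hP hsel hζm g₀ os hρ0 hρ1 hn => shellWeightBound_crGap₁₃VAt' 0 jcut ρ n θ hP g₀ os (E F θ) hsel hζm hρ0 hρ1 hn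

end LiveSF

end Summit.QuantumFields.YangMills.Theorems.N21ShellSplitOfRecord13CoPH

end
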